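import Literature.Computability.Cryptography.Schemes
import Literature.Computability.Cryptography.SchemesOWFProgram
import HarnessLib

/-!
# Crypto foundations S13: secure private-key encryption implies one-way functions — discharge

(Sibling of `SchemesProofs.lean`, which holds the signature case and the assembled corollaries.)

Discharge of the named fact `Literature.Computability.Cryptography.OWFExist_of_secureSKEExist`
(`Schemes.lean`; **crypto-foundations.S13**, Impagliazzo–Luby 1989, Thm. 1, private-key case):
`SecureSKEExist → OWFExist`. The mathematics is `SchemesOWF.lean` (the candidate `F`, the
distinguisher, the counting/simulation argument and the asymptotics, following Goldreich's
rendering of the Impagliazzo–Luby theorem: FoC II §5.5 Exercise 2 with FoC I §3.8 Exercise 11,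
"disjoint case" — perfect correctness makes the two ciphertext-vector distributions almost
disjoint, so a plain inverter of the constructible ensemble's sampler already distinguishes and
distributional one-wayness is not needed) and the machine facts are `SchemesOWFProgram.lean`
(`blockFn`, `F` and the distinguisher's run function are polynomial-time, by plumbing bricks). Here
the polynomial bounds of the scheme are extracted from `IsEfficient` and everything is assembled.

## References

* R. Impagliazzo, M. Luby, *One-way functions are essential for complexity based cryptography*,
  FOCS 1989, Thm. 1.
* O. Goldreich, *Foundations of Cryptography II: Basic Applications*, CUP 2004, §5.5 Exercise 2;
  *Foundations of Cryptography I: Basic Tools*, CUP 2001, §3.8 Exercise 11, Prop. 3.3.8, §2.3.1.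
-/

namespace Literature.Computability.Cryptography

open _root_.Computability Complexity Polynomial

/-- **Discharge of crypto-foundations.S13 (private-key encryption ⇒ OWF)**: if there is an
efficient, correct private-key encryption scheme with indistinguishable multiple encryptions, then
(strong) one-way functions exist. The one-way function is `SKEOWF.Params.F`: on an input of length
`N` it evaluates, on `Mof N` consecutive blocks of each length `j ≤ Mof N`, the block function that
reads a block of a good length as (world bit, key-generation coins, encryption coins) and outputs the
encoded ciphertext vector of the fixed plaintext vector of that world; `SKEOWF.Params.isOneWay_F`
shows it is one-way from correctness and multiple-message security, and the three machine facts are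
`SKEOWF.blockFn_mem_FP`, `SKEOWF.F_mem_FP`, `SKEOWF.drun_polyTime`.
[Impagliazzo–Luby 1989, Thm. 1; Goldreich 2004, §5.5 Exercise 2; Goldreich 2001, §3.8 Exercise 11]
[cite: ImpagliazzoLuby1989, Thm. 1] -/
theorem OWFExist_of_secureSKEExist_holds : OWFExist_of_secureSKEExist := by
  rintro ⟨S, ⟨hG, hEnc, -⟩, hC, hsec⟩
  obtain ⟨pG, hpG⟩ := hG.2
  obtain ⟨pE, hpE⟩ := hEnc.2
  obtain ⟨pKo, hpKo⟩ := SKEOWF.exists_poly_length_le_of_polyTime hG.1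
  have hσ : ∀ n, S.keyGen.coinLen (unaryEncodeNat n).length ≤ pG.eval n := fun n => by
    rw [SKEScheme.length_unaryEncodeNat]; exact hpG n
  have hK : ∀ (n : ℕ) (s : List Bool), s.length = S.keyGen.coinLen (unaryEncodeNat n).length →
      (S.keyGen.run n s).length ≤ (pKo.comp (2 * X + 2 + pG)).eval n := by
    intro n s hs
    have h := hpKo (n, s)
    simp only [id, length_boolPair, SKEScheme.length_unaryEncodeNat, Function.uncurry] at h
    refine h.trans ?_
    rw [eval_comp]
    refine Complexity.natPoly_eval_mono _ ?_
    have := hσ n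
    simp only [eval_add, eval_mul, eval_ofNat, eval_X]
    omega
  set P : SKEOWF.Params := ⟨S, pG, pKo.comp (2 * X + 2 + pG), pE⟩ with hP
  have hb := SKEOWF.blockFn_mem_FP P hG hEnc
  obtain ⟨sf, hsf⟩ := exists_poly_length_le_of_mem_FP hb
  exact ⟨P.F sf, SKEOWF.Params.isOneWay_F P hK hσ hpE hC hsec hsf (SKEOWF.F_mem_FP P hG hEnc hsf)
    fun A hA Bd => SKEOWF.drun_polyTime P hG hEnc hsf A hA Bd⟩

end Literature.Computability.Cryptography
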